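import Literature.NumberTheory.Weil1965.ThetaIntegralOrbitFunctionalSupport
import HarnessLib

/-!
# The theta-side null fibre: `μ̂_0 = 0` (Weil: `U(0)_F = ∅` for an anisotropic form)

Topic `NumberTheory/Weil1965`; namespaces `Literature.NumberTheory.Weil1965` (§1–§2, generic) and
`Literature.NumberTheory.Weil1965.UnitaryDoubling` (§3, the dual pair).  KERNEL MATHEMATICS ONLY: proved theorems, no definition,
no named fact, no `sorry`.  Sequel of ★ `ThetaIntegralOrbitFunctionalSupport`, companion of ★ `AdelicFibreMeasures` §2.
Weil [Weil1965, Chap. IV n° 41 (35), p. 59; n° 51, p. 74]: the fibre measure `μ_0` of an ANISOTROPIC form vanishes because no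
rational point `ξ ≠ 0` has `i_X(ξ) = 0`.  For the orbit functional `Λ(Φ) = ∫_{G/Γ} Σ'_{ξ≠0} Φ(A(g) ξ) dν` with an invariant,
rationally valued `h` (★ `orbitFunctionalReal_support`): every orbit point `A(g) ξ` has `h(A(g) ξ) = h(ξ) ∈ F ∖ {0}` under the
anisotropy hypothesis `hanis : ξ ≠ 0 → h(ξ) ≠ 0`; since `F` is DISCRETE in `𝔸_F` (★ `AdeleRing.exists_isOpen_forall_algebraMap_mem_eq_zero`)
there is an open `V ∋ 0` with `V ∩ F = {0}`, the open set `h⁻¹(V) ⊇ h⁻¹(0)` contains no orbit point, `Λ` kills every test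
function supported in it, so it is `ν_Λ`-null and `μ̂_0 = ν_Λ|_{h⁻¹(0)} = 0`.
* §1 `schwartzBruhatMeasure_apply_eq_zero_of_isOpen` — support control of `ν_S` on an ARBITRARY open set (the proof pattern of ★
  `schwartzBruhatMeasure_apply_eq_zero`);
* §2 `orbitFunctionalReal_eq_zero_of_tsupport_subset_preimage`, `exists_isOpen_schwartzBruhatMeasure_orbitFunctionalReal_preimage_eq_zero`,
  **`schwartzBruhatMeasure_orbitFunctionalReal_preimage_zero`**, **`fibreMeasure_orbitFunctionalReal_zero`**;
* §3 the dual pair (`h = hNorm`; `hanis` is the Theorems-side ★ `E2SWHNormAnisotropic.hNorm_ratPt_eq_zero_iff` of A-p18):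
  **`schwartzBruhatMeasure_thetaOrbitFunctionalReal_preimage_zero`**, **`fibreMeasure_thetaOrbitFunctionalReal_zero`** (`μ̂_0 = 0`).

## References
* [Weil1965] A. Weil, *Sur la formule de Siegel dans la théorie des groupes classiques*, Acta Math. 113 (1965): Chap. IV n° 41
  (35) p. 59; n° 51 p. 74.
* [CasselsFrohlichANT1967] J. W. S. Cassels, A. Fröhlich (eds.), *Algebraic Number Theory* (1967), Ch. II §14 (discreteness of
  `K` in `𝔸_K`).
-/

set_option autoImplicit false

noncomputable section

namespace Literature.NumberTheory.Weil1965

open Literature.NumberTheory.Automorphic Literature.NumberTheory.Weil1964 Literature.MeasureTheory.RieszRepresentation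
open NumberField _root_.MeasureTheory _root_.Topology Set
open scoped Matrix

/-! ### §1 Support control of `ν_S` on an arbitrary open set -/

section OpenSupport

variable (F : Type) [Field F] [NumberField F] (ι : Type) [Fintype ι]
  [MeasurableSpace (AdeleRing (𝓞 F) F)] [BorelSpace (AdeleRing (𝓞 F) F)]
  (S : piSchwartzBruhatReal F ι →ₗ[ℝ] ℝ)
  (hS : ∀ Ψ : piSchwartzBruhatReal F ι, 0 ≤ (Ψ : (ι → AdeleRing (𝓞 F) F) → ℝ) → 0 ≤ S Ψ)

/-- **Support control on an open set**: if `S` kills every `Ψ ∈ 𝒮_ℝ(X)` supported in a compact subset of the open set `U`,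
then `ν_S(U) = 0` (the proof of ★ `schwartzBruhatMeasure_apply_eq_zero`, for an arbitrary open `U`).
[cite: Weil1965, Chap. I n° 2, Lemme 3, p. 7] -/
theorem schwartzBruhatMeasure_apply_eq_zero_of_isOpen {U : Set (ι → AdeleRing (𝓞 F) F)} (hU : IsOpen U)
    (hS0 : ∀ (Ψ : piSchwartzBruhatReal F ι) (L : Set (ι → AdeleRing (𝓞 F) F)), IsCompact L → L ⊆ U →
      tsupport (Ψ : (ι → AdeleRing (𝓞 F) F) → ℝ) ⊆ L → S Ψ = 0) :
    schwartzBruhatMeasure F ι S hS U = 0 := by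
  haveI := secondCountableTopology_adeleRing (K := F)
  haveI : BorelSpace (ι → AdeleRing (𝓞 F) F) := Pi.borelSpace
  haveI : T2Space (IsDedekindDomain.FiniteAdeleRing (𝓞 F) F) := inferInstanceAs <| T2Space
    (RestrictedProduct (fun w : IsDedekindDomain.HeightOneSpectrum (𝓞 F) => w.adicCompletion F)
      (fun w => (w.adicCompletionIntegers F : Set (w.adicCompletion F))) Filter.cofinite)
  haveI : T2Space (InfiniteAdeleRing F) := inferInstanceAs <| T2Space ((w : InfinitePlace F) → w.Completion)
  haveI : T2Space (AdeleRing (𝓞 F) F) := inferInstanceAs <| T2Space (InfiniteAdeleRing F × IsDedekindDomain.FiniteAdeleRing (𝓞 F) F)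
  haveI : T2Space (ι → AdeleRing (𝓞 F) F) := inferInstance
  haveI := locallyCompactSpace_adeleRing' (K := F)
  haveI : LocallyCompactSpace (ι → AdeleRing (𝓞 F) F) := inferInstance
  refine sandwichMeasure_apply_eq_zero_of_forall _ _ hU fun g hg => ?_
  obtain ⟨L, hLc, hgL, hLU⟩ := exists_compact_between g.hasCompactSupport hU hg
  obtain ⟨Ψ₁, Ψ₂, h₁, h₂, -, -, -, -, -, hs₁, hs₂⟩ :=
    piSchwartzBruhatReal_sandwich_of_subset S hS g isOpen_interior hgL one_pos
  have hz₁ := hS0 Ψ₁ L hLc hLU (hs₁.trans interior_subset)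
  have hz₂ := hS0 Ψ₂ L hLc hLU (hs₂.trans interior_subset)
  exact le_antisymm ((sandwichFunctional_le _ _ h₂).trans_eq hz₂)
    (hz₁.symm.trans_le (le_sandwichFunctional _ _ h₁))

end OpenSupport

/-! ### §2 Generic: the null fibre of the orbit functional along an anisotropic invariant -/

section Generic

variable (F : Type) [Field F] [NumberField F] {m : ℕ}
variable {G : Type*} [Group G] [TopologicalSpace G] [IsTopologicalGroup G] [LocallyCompactSpace G]
variable (Γ : Subgroup G) [CompactSpace (G ⧸ Γ)] [MeasurableSpace (G ⧸ Γ)] [BorelSpace (G ⧸ Γ)]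
variable (ν : Measure (G ⧸ Γ)) [IsFiniteMeasure ν]
variable (A : G →* ((Fin m → AdeleRing (𝓞 F) F) ≃ₗ[AdeleRing (𝓞 F) F] (Fin m → AdeleRing (𝓞 F) F)))
variable (hA : ∀ x : Fin m → AdeleRing (𝓞 F) F, Continuous fun g => A g x)
variable (hΓ : ∀ γ ∈ Γ, ∀ ξ : Fin m → F, ∃ ξ' : Fin m → F, A γ (ratPt F (Fin m) ξ) = ratPt F (Fin m) ξ')
variable (h : (Fin m → AdeleRing (𝓞 F) F) → AdeleRing (𝓞 F) F)
  (hinv : ∀ (g : G) (x : Fin m → AdeleRing (𝓞 F) F), h (A g x) = h x)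
  (hrat : ∀ ξ : Fin m → F, h (ratPt F (Fin m) ξ) ∈ Set.range (algebraMap F (AdeleRing (𝓞 F) F)))
  (hanis : ∀ ξ : Fin m → F, ξ ≠ 0 → h (ratPt F (Fin m) ξ) ≠ 0)

include hA hinv hrat hanis in
/-- **`Λ_ℝ` kills every `Ψ` supported in `h⁻¹(V)` when `V ∩ F = {0}`**: every orbit point `A(g) ξ`, `ξ ≠ 0`, has
`h(A(g) ξ) = h(ξ) ∈ F ∖ {0}`, hence `∉ V`. [cite: Weil1965, Chap. IV n° 41, (35) p. 59] -/
theorem orbitFunctionalReal_eq_zero_of_tsupport_subset_preimage {V : Set (AdeleRing (𝓞 F) F)}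
    (hV : ∀ k : F, algebraMap F (AdeleRing (𝓞 F) F) k ∈ V → k = 0) (Ψ : piSchwartzBruhatReal F (Fin m))
    (hΨ : tsupport (Ψ : (Fin m → AdeleRing (𝓞 F) F) → ℝ) ⊆ h ⁻¹' V) :
    orbitFunctionalReal F Γ ν A hA hΓ Ψ = 0 := by
  rw [orbitFunctionalReal_apply, orbitFunctional_eq_zero_of_forall F Γ ν A hA hΓ (ofRealSB F Ψ) fun g ξ => ?_,
    Complex.zero_re]
  obtain ⟨k, hk⟩ := hrat (ξ : Fin m → F)
  have hx : A g (ratPt F (Fin m) (ξ : Fin m → F)) ∉ tsupport (Ψ : (Fin m → AdeleRing (𝓞 F) F) → ℝ) := fun hx => by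
    have hV' := hΨ hx
    rw [Set.mem_preimage, hinv, ← hk] at hV'
    refine hanis (ξ : Fin m → F) ξ.2 ?_
    rw [← hk, hV k hV', map_zero]
  rw [coe_ofRealSB, image_eq_zero_of_notMem_tsupport hx, Complex.ofReal_zero]

include hA hinv hrat hanis in
/-- **an open `ν_Λ`-null neighbourhood of the null fibre**: there is an open `V ∋ 0` in `𝔸_F` with `ν_{Λ_ℝ}(h⁻¹ V) = 0`
(`F` discrete in `𝔸_F`, ★ `AdeleRing.exists_isOpen_forall_algebraMap_mem_eq_zero`, and §1).
[cite: Weil1965, Chap. IV n° 41, (35) p. 59] -/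
theorem exists_isOpen_schwartzBruhatMeasure_orbitFunctionalReal_preimage_eq_zero [MeasurableSpace (AdeleRing (𝓞 F) F)]
    [BorelSpace (AdeleRing (𝓞 F) F)] (hh : Continuous h) :
    ∃ V : Set (AdeleRing (𝓞 F) F), IsOpen V ∧ (0 : AdeleRing (𝓞 F) F) ∈ V ∧
      schwartzBruhatMeasure F (Fin m) (orbitFunctionalReal F Γ ν A hA hΓ) (orbitFunctionalReal_nonneg F Γ ν A hA hΓ)
        (h ⁻¹' V) = 0 := by
  obtain ⟨V, hVo, hV0, hV⟩ := AdeleRing.exists_isOpen_forall_algebraMap_mem_eq_zero F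
  exact ⟨V, hVo, hV0, schwartzBruhatMeasure_apply_eq_zero_of_isOpen F (Fin m) _ _ (hVo.preimage hh)
    fun Ψ L _ hLU hΨL => orbitFunctionalReal_eq_zero_of_tsupport_subset_preimage F Γ ν A hA hΓ h hinv hrat hanis hV Ψ
      (hΨL.trans hLU)⟩

include hA hinv hrat hanis in
/-- **THE NULL FIBRE IS `ν_Λ`-NULL**: `ν_{Λ_ℝ}(h⁻¹(0)) = 0`. [cite: Weil1965, Chap. IV n° 41, (35) p. 59] -/
theorem schwartzBruhatMeasure_orbitFunctionalReal_preimage_zero [MeasurableSpace (AdeleRing (𝓞 F) F)]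
    [BorelSpace (AdeleRing (𝓞 F) F)] (hh : Continuous h) :
    schwartzBruhatMeasure F (Fin m) (orbitFunctionalReal F Γ ν A hA hΓ) (orbitFunctionalReal_nonneg F Γ ν A hA hΓ)
      (h ⁻¹' {0}) = 0 := by
  obtain ⟨V, -, hV0, hnull⟩ :=
    exists_isOpen_schwartzBruhatMeasure_orbitFunctionalReal_preimage_eq_zero F Γ ν A hA hΓ h hinv hrat hanis hh
  exact measure_mono_null (Set.preimage_mono (Set.singleton_subset_iff.2 hV0)) hnull

include hA hinv hrat hanis in
/-- **`μ̂_0 = 0`**: the fibre measure of `Λ_ℝ` along `h` at `b = 0` vanishes. [cite: Weil1965, Chap. IV n° 41, (35) p. 59; n° 51 p. 74] -/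
theorem fibreMeasure_orbitFunctionalReal_zero [MeasurableSpace (AdeleRing (𝓞 F) F)] [BorelSpace (AdeleRing (𝓞 F) F)]
    (hh : Continuous h) :
    fibreMeasure F (Fin m) (orbitFunctionalReal F Γ ν A hA hΓ) (orbitFunctionalReal_nonneg F Γ ν A hA hΓ) h 0 = 0 := by
  rw [fibreMeasure, Measure.restrict_eq_zero, map_zero]
  exact schwartzBruhatMeasure_orbitFunctionalReal_preimage_zero F Γ ν A hA hΓ h hinv hrat hanis hh

end Generic

end Literature.NumberTheory.Weil1965

/-! ### §3 The dual pair: `μ̂_0 = 0` for `h = hNorm` under anisotropy -/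

namespace Literature.NumberTheory.Weil1965.UnitaryDoubling

open _root_.MeasureTheory NumberField
open Literature.NumberTheory.Weil1964 Literature.NumberTheory.Weil1965 Literature.NumberTheory.Automorphic
open Literature.NumberTheory.GelbartRogawski1991 Literature.NumberTheory.GelbartRogawski1991.UnitaryDualPair

section DualPair

variable (F E : Type) [Field F] [NumberField F] [Field E] [NumberField E] [Algebra F E] [Algebra.IsQuadraticExtension F E]
  (c : E ≃ₐ[F] E) {δ : E} (hcδ : c δ = -δ) (hδ : δ ≠ 0) {d : F} (hd : δ * δ = algebraMap F E d)
  (N : ℕ) {n : ℕ} (e : Fin N × Fin 1 ≃ Fin n)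
  (TV : Matrix (Fin N) (Fin N) F) (hV : TV.IsSymm) (hVd : IsUnit TV.det)
  (TW : Matrix (Fin 1) (Fin 1) F) (hW : TW.IsSymm) (hWd : IsUnit TW.det)
  [LocallyCompactSpace (UnitaryGroup.adelic F E c N (TV.map (algebraMap F E)))]
  [CompactSpace (UnitaryGroup.adelic F E c N (TV.map (algebraMap F E)) ⧸ (UnitaryGroup.toAdelic F E c N (TV.map (algebraMap F E))).range)]
  [MeasurableSpace (UnitaryGroup.adelic F E c N (TV.map (algebraMap F E)) ⧸ (UnitaryGroup.toAdelic F E c N (TV.map (algebraMap F E))).range)]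
  [BorelSpace (UnitaryGroup.adelic F E c N (TV.map (algebraMap F E)) ⧸ (UnitaryGroup.toAdelic F E c N (TV.map (algebraMap F E))).range)]
  (ν : Measure (UnitaryGroup.adelic F E c N (TV.map (algebraMap F E)) ⧸ (UnitaryGroup.toAdelic F E c N (TV.map (algebraMap F E))).range)) [IsFiniteMeasure ν]
  [MeasurableSpace (AdeleRing (𝓞 F) F)] [BorelSpace (AdeleRing (𝓞 F) F)]
  (hanis : ∀ ξ : Fin (n + n) → F, ξ ≠ 0 → hNorm F E c hcδ hδ N e TV hVd TW hWd (ratPt F (Fin (n + n)) ξ) ≠ 0)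

include hd hanis in
/-- **THE CONE `hNorm = 0` IS `ν_{Λ_θ}`-NULL** under anisotropy (`ξ ≠ 0 → hNorm ξ ≠ 0` on rational points; Theorems-side this is
★ `E2SWHNormAnisotropic.hNorm_ratPt_eq_zero_iff`). [cite: Weil1965, Chap. IV n° 41, (35) p. 59; n° 51 p. 74] -/
theorem schwartzBruhatMeasure_thetaOrbitFunctionalReal_preimage_zero :
    schwartzBruhatMeasure F (Fin (n + n)) (thetaOrbitFunctionalReal F E c hcδ hδ hd N e TV hV hVd TW hW hWd ν)
        (thetaOrbitFunctionalReal_nonneg F E c hcδ hδ hd N e TV hV hVd TW hW hWd ν)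
      ((hNorm F E c hcδ hδ N e TV hVd TW hWd) ⁻¹' {0}) = 0 :=
  schwartzBruhatMeasure_orbitFunctionalReal_preimage_zero F (UnitaryGroup.toAdelic F E c N (TV.map (algebraMap F E))).range ν
    (vDiagAct F E c hcδ hδ hd N e TV hV hVd TW hW hWd) (continuous_vDiagAct_apply F E c hcδ hδ hd N e TV hV hVd TW hW hWd)
    (vDiagAct_ratPt_of_mem F E c hcδ hδ hd N e TV hV hVd TW hW hWd) (hNorm F E c hcδ hδ N e TV hVd TW hWd)
    (hNorm_vDiagAct F E c hcδ hδ hd N e TV hV hVd TW hW hWd) (hNorm_ratPt_mem_range F E c hcδ hδ hd N e TV hVd TW hWd) hanis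
    (continuous_hNorm F E c hcδ hδ N e TV hVd TW hWd)

include hd hanis in
/-- **`μ̂_0 = 0` FOR THE DUAL PAIR**: the theta-side fibre measure at `b = 0` vanishes (Weil's `U(0)_F = ∅`).
[cite: Weil1965, Chap. IV n° 41, (35) p. 59; n° 51 p. 74] -/
theorem fibreMeasure_thetaOrbitFunctionalReal_zero :
    fibreMeasure F (Fin (n + n)) (thetaOrbitFunctionalReal F E c hcδ hδ hd N e TV hV hVd TW hW hWd ν)
        (thetaOrbitFunctionalReal_nonneg F E c hcδ hδ hd N e TV hV hVd TW hW hWd ν)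
        (hNorm F E c hcδ hδ N e TV hVd TW hWd) 0 = 0 :=
  fibreMeasure_orbitFunctionalReal_zero F (UnitaryGroup.toAdelic F E c N (TV.map (algebraMap F E))).range ν
    (vDiagAct F E c hcδ hδ hd N e TV hV hVd TW hW hWd) (continuous_vDiagAct_apply F E c hcδ hδ hd N e TV hV hVd TW hW hWd)
    (vDiagAct_ratPt_of_mem F E c hcδ hδ hd N e TV hV hVd TW hW hWd) (hNorm F E c hcδ hδ N e TV hVd TW hWd)
    (hNorm_vDiagAct F E c hcδ hδ hd N e TV hV hVd TW hW hWd) (hNorm_ratPt_mem_range F E c hcδ hδ hd N e TV hVd TW hWd) hanis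
    (continuous_hNorm F E c hcδ hδ N e TV hVd TW hWd)

end DualPair

end Literature.NumberTheory.Weil1965.UnitaryDoubling
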